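import Summits.ResolutionOfSingularities.ResolutionOfSingularities.Theorems.PurelyInseparableDim4ResConeCInfPinningUTwoState
import HarnessLib
import HarnessLib.Audit.Tags

/-!
# Purely inseparable four-folds — C∞ PINNING, free half, TWO-STATE FORM, FOR EVERY PRIME `p` ((VT-u) ∀ p): a slot step of a
# C∞-presented state of order `d + 2` (`d + 1 = p`) whose child keeps order `d + 2` and `e_G = 3` has no `u`-translation
# (cell `res-dim4-pi`, K2(p) lane, rung-1 POWER-CONE LINE «light pair of TAIL(p, p−1, 3) ∀ p», window half W4a; the `p = 5`
# instance is res-dim4-p-2 g5's `…ResConeCInfPinningUTwoState` p700562)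

[OURS · counted 0 · cell `res-dim4-pi` · K2(p) lane (holder res-dim4-p-12 g5, rulings g5-2 (6) / g5-6) · seat res-dim4-typ-1 g5
(first refusal of res-dim4-p-2 g6 on the bus 2026-08-29 10:12:40Z, not taken); the argument is res-dim4-p-2 g5's VERBATIM with the
dictionary below, over the holder's p-generic two-state alignment lemma `exists_births_eq_mul_of_finrank_step_eq_three`
(`…ResConePowerConeTilt`) and res-dim4-p-5 g3's one-letter shear law `coeff_shear_single` (`…ResConeShearTransport`).]  Nothing here
proves K2(p) for any `p`, any TAIL(p, p−1, 3), any TAIL(7, d, e), `NoIsolatedTrap p p` or resolution of singularities in dimension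
≥ 4 / characteristic `p` — NOT proved.  AI kernel work, weaker than expert review.  A state-level reading lemma for OUR frame.

DICTIONARY against `5` (`d + 1 = p`, `2 ≤ d`): order `6 ↦ d + 2`, residual `x_f⁴ ↦ x_f^d`, exact ledger `e_f ≤ 3 ↦ e_f ≤ d − 1`,
**dead «`ū²`-row» `↦` dead `ū^{d−2}`-row** (`¬ (e u = d − 2 ∧ e f = 0)` below degree `N ≥ d + 4`), **flag `V = coeff (r + λ + μ + 3u)
↦ coeff (r + λ + μ + (d−1)u)`**, and `3 ≠ 0 ↦ ((d − 1 : ℕ) : K) ≠ 0` (automatic: `0 < d − 1 < p`).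
THE STATEMENT (`cInf_translation_u_eq_zero_twoState_prime`): letters `λ μ | u f`; a state `s` with ledger `r = e_λ + e_μ`, order
`d + 2`, `x^r ∣ F`, straight residual `a·x_f^d` (`a ≠ 0`), exact pair ledger, dead `ū^{d−2}`-row below `N ≥ d + 4`, flag `V ≠ 0`;
if the child by the slot step `ℓ ∈ {λ, μ}` with translation `β·e_u` has order `d + 2` and `e_G = 3`, then `β = 0`.
THE PROOF (no chain): the parent vertex is `{w_f = 0}` (`mem_resVertex_iff_of_resForm_eq_C_mul_X_pow (p)`, `1 ≤ d < p`); the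
ledger is kept, so the shade is kept; the alignment lemma (`p < d + 2`, `d + 3 < 2p`, `d < p`) makes the birth
`coeff_{μ₀ + 2e_κ} (shear G)` proportional to `coeff_{μ₀} (x_f^{d−1})`, hence ZERO at `μ₀ = e_o + (d−2)e_u`; `coeff_shear_single`
reads that birth as the THREE-term sum `1·coeff(r + 2κ + o + (d−2)u) + C(d−1,1)·β·V + C(d,2)·β²·coeff(r + o + d·u)` — always three
terms, the chart exponent being `2` —, i.e. `0 + (d−1)βV + 0` (dead row at degree `d + 3 < N`; ledger: `κ`-exponent `1 < 2` at
`f`-degree `0`), so `β = 0`.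
[cite: CossartJannsenSaito2020, Thm. 3.10(4), Thm. 9.3] [cite: Hauser2010, §§F, I]
bears_on: LADDER-RESOLUTION:D157-DOOR2 (res-dim4-pi · K2(p) · power cones · (VT-u) two-state ∀ p).  Supports
stmt-ResolutionOfSingularities-16155 (helper).
-/

set_option linter.dupNamespace false -- mandated namespace of this single-conjunct summit

noncomputable section

namespace Summit.ResolutionOfSingularities.ResolutionOfSingularities.Theorems.PIDim4

namespace ResCone

open MvPolynomial Finset
open Literature.AlgebraicGeometry.Resolution
open Literature.AlgebraicGeometry.Resolution.CentreBlowup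
open Literature.AlgebraicGeometry.Resolution.Hauser2010
open Literature.AlgebraicGeometry.Resolution.HauserPerlega2019
open PointBlowup (polarMap additiveSubspace)

variable {K : Type} [Field K] [DecidableEq K]

/-! ## 1. The ledger is kept by a slot step translated along the free letter, every prime -/

/-- **A slot step translated along the free letter keeps the two-slot ledger, every prime**: with `r = e_κ + e_o`, order
`d + 2 = p + 1`, `x^r ∣ F`, the `Step p` in chart `κ` with translation `β·e_u` (`u ∉ {κ, o}`) has `r′ = e_κ + e_o`. [folklore]
[cite: HauserPerlega2019PRIMS, §2 (transform D' of D)] -/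
theorem step_r_single_free_eq_prime (p : ℕ) {d : ℕ} (hdp : d + 1 = p) {κ o u f : Fin 4} (hκo : κ ≠ o) (hκu : κ ≠ u)
    (hκf : κ ≠ f) (hou : o ≠ u) (hof : o ≠ f) (huf : u ≠ f) {s : State K} (hr : s.r = Finsupp.single κ 1 + Finsupp.single o 1)
    (ho : ordZero s.F = ((d + 2 : ℕ) : ℕ∞)) (hdiv : ∀ e ∈ s.F.support, s.r ≤ e) (β : K) :
    (CentreBlowup.step p Finset.univ κ (Pi.single u β) s).r = Finsupp.single κ 1 + Finsupp.single o 1 := by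
  have hbκ : (Pi.single u β : Fin 4 → K) κ = 0 := by rw [Pi.single_eq_of_ne hκu]
  rw [step_r_univ p κ hbκ s ho hdiv, hr, show d + 2 - p = 1 by omega]
  have hr4 : (Finsupp.single κ 1 + Finsupp.single o 1 : Fin 4 →₀ ℕ) =
      Finsupp.single κ 1 + Finsupp.single o 1 + Finsupp.single u 0 + Finsupp.single f 0 := by
    rw [Finsupp.single_zero, Finsupp.single_zero, add_zero, add_zero]
  obtain ⟨h1, h2, h3, h4⟩ := quad_apply hκo hκu hκf hou hof huf 1 1 0 0
  rw [← hr4] at h1 h2 h3 h4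
  ext i
  rw [Finsupp.update_apply, Finsupp.filter_apply]
  rcases letters_exhaust hκo hκu hκf hou hof huf i with h | h | h | h <;> rw [h]
  · rw [if_pos rfl, h1]
  · rw [if_neg hκo.symm, if_pos (show (Pi.single u β : Fin 4 → K) o = 0 by rw [Pi.single_eq_of_ne hou]), h2]
  · rw [if_neg hκu.symm, h3]; exact ite_self 0
  · rw [if_neg hκf.symm, h4]; exact ite_self 0

/-! ## 2. The two-state (VT-u), every prime -/

/-- **(VT-u), TWO-STATE CORE, every prime** (chart `κ`, other slot `o`, free letters `u`, `f`): see the module docstring.  The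
child of the slot step `κ` with translation `β·e_u` having order `d + 2` and `e_G = 3` forces `β = 0`. [OURS]
[cite: CossartJannsenSaito2020, Thm. 3.10(4), Thm. 9.3] -/
theorem cInf_translation_u_eq_zero_twoState_core_prime (p : ℕ) [Fact p.Prime] [CharP K p] {d : ℕ} (hdp : d + 1 = p)
    (hd2 : 2 ≤ d) {κ o u f : Fin 4} (hκo : κ ≠ o) (hκu : κ ≠ u) (hκf : κ ≠ f) (hou : o ≠ u) (hof : o ≠ f) (huf : u ≠ f)
    {s : State K} (hr : s.r = Finsupp.single κ 1 + Finsupp.single o 1) (ho : ordZero s.F = ((d + 2 : ℕ) : ℕ∞))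
    (hdiv : ∀ e ∈ s.F.support, s.r ≤ e) {a : K} (ha : a ≠ 0) (hform : resForm s = C a * X f ^ d)
    (hled : ∀ e ∈ s.F.support, e f ≤ d - 1 → 2 ≤ e κ ∧ 2 ≤ e o) {N : ℕ} (hN : d + 4 ≤ N)
    (hrow : ∀ e ∈ s.F.support, e.degree < N → ¬ (e u = d - 2 ∧ e f = 0))
    (hV : coeff (s.r + (Finsupp.single κ 1 + Finsupp.single o 1 + Finsupp.single u (d - 1))) s.F ≠ 0)
    {β : K} (ho' : ordZero (CentreBlowup.step p Finset.univ κ (Pi.single u β) s).F = ((d + 2 : ℕ) : ℕ∞))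
    (he3' : Module.finrank K (resVertex (CentreBlowup.step p Finset.univ κ (Pi.single u β) s)) = 3) : β = 0 := by
  classical
  have hp : p.Prime := Fact.out
  have hp2 : 2 ≤ p := hp.two_le
  have hbκ : (Pi.single u β : Fin 4 → K) κ = 0 := by rw [Pi.single_eq_of_ne hκu]
  have hrdeg : s.r.degree = 2 := by rw [hr, map_add, Finsupp.degree_single, Finsupp.degree_single]
  -- the shade is kept
  have hr' := step_r_single_free_eq_prime p hdp hκo hκu hκf hou hof huf hr ho hdiv β
  have hrdeg' : (CentreBlowup.step p Finset.univ κ (Pi.single u β) s).r.degree = 2 := by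
    rw [hr', map_add, Finsupp.degree_single, Finsupp.degree_single]
  have heq : (CentreBlowup.step p Finset.univ κ (Pi.single u β) s).shade = s.shade := by
    rw [BandShade.shade_eq_coe ho', BandShade.shade_eq_coe ho, hrdeg, hrdeg']
  -- the parent's vertex is `{w_f = 0}`
  have hV0 : ∀ w, w ∈ resVertex s ↔ dotProduct (Pi.single f (1 : K)) w = 0 :=
    mem_resVertex_iff_of_resForm_eq_C_mul_X_pow p ha (n := d) (by omega) (by omega) hform
  have hℓ0 : (Pi.single f (1 : K) : Fin 4 → K) ≠ 0 := fun h => by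
    have h1 := congr_fun h f
    rw [Pi.single_eq_same, Pi.zero_apply] at h1
    exact one_ne_zero h1
  -- the birth layer is aligned with `x_f^{d−1}`
  obtain ⟨κ', hB⟩ := exists_births_eq_mul_of_finrank_step_eq_three p κ hbκ ho hdiv (by omega) (by omega) heq
    (by rw [hrdeg]; omega) hV0 hℓ0 he3'
  -- the birth at `μ₀ = e_o + (d−2)e_u` vanishes
  set μ₀ : Fin 4 →₀ ℕ := Finsupp.single o 1 + Finsupp.single u (d - 2) with hμ₀
  have hμ₀κ : μ₀ κ = 0 := by
    rw [hμ₀, Finsupp.add_apply, Finsupp.single_eq_of_ne hκo, Finsupp.single_eq_of_ne hκu, add_zero]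
  have hμ₀deg : μ₀.degree + 1 = d + 2 - s.r.degree := by
    rw [hrdeg, hμ₀, map_add, Finsupp.degree_single, Finsupp.degree_single]
    omega
  have hBμ := hB μ₀ hμ₀κ hμ₀deg
  have hupd0 : Function.update (Pi.single f (1 : K) : Fin 4 → K) κ 0 = (Pi.single f (1 : K) : Fin 4 → K) := by
    funext i
    by_cases hi : i = κ
    · subst hi; rw [Function.update_self, Pi.single_eq_of_ne hκf]
    · rw [Function.update_of_ne hi]
  have hsum : (∑ i, C ((Pi.single f (1 : K) : Fin 4 → K) i) * X i : MvPolynomial (Fin 4) K) = X f := by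
    rw [Finset.sum_eq_single f (fun i _ hif => by rw [Pi.single_eq_of_ne hif, C_0, zero_mul])
      (fun h => absurd (Finset.mem_univ f) h), Pi.single_eq_same, C_1, one_mul]
  have hcoef0 : coeff μ₀ ((∑ i, C (Function.update (Pi.single f (1 : K) : Fin 4 → K) κ 0 i) * X i :
      MvPolynomial (Fin 4) K) ^ (d + 2 - s.r.degree - 1)) = 0 := by
    rw [hupd0, hsum, hrdeg, X_pow_eq_monomial, coeff_monomial, if_neg]
    intro h
    have h1 := DFunLike.congr_fun h o
    rw [Finsupp.single_eq_of_ne hof, hμ₀, Finsupp.add_apply, Finsupp.single_eq_same,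
      Finsupp.single_eq_of_ne hou] at h1
    omega
  rw [hcoef0, mul_zero] at hBμ
  -- read the birth through the one-letter shear: `1·0 + (d−1)·β·V + C(d,2)·β²·0`
  rw [coeff_shear_single hκu β] at hBμ
  have heκ : (μ₀ + Finsupp.single κ 2 : Fin 4 →₀ ℕ) κ = 2 := by
    rw [Finsupp.add_apply, hμ₀κ, Finsupp.single_eq_same]
  have heu : (μ₀ + Finsupp.single κ 2 : Fin 4 →₀ ℕ) u = d - 2 := by
    rw [Finsupp.add_apply, hμ₀, Finsupp.add_apply, Finsupp.single_eq_of_ne hou.symm, Finsupp.single_eq_same,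
      Finsupp.single_eq_of_ne hκu.symm, zero_add, add_zero]
  rw [heκ, heu, Finset.sum_range_succ, Finset.sum_range_succ, Finset.sum_range_succ, Finset.sum_range_zero,
    zero_add] at hBμ
  -- the three exponents, in `F`-coordinates
  have hupd : ∀ x y x' y' : ℕ, x = x' → y = y' →
      ((μ₀ + Finsupp.single κ 2).update κ x).update u y =
        Finsupp.single κ x' + Finsupp.single o 1 + Finsupp.single u y' + Finsupp.single f 0 := by
    intro x y x' y' hx hy
    subst hx; subst hy
    obtain ⟨h1, h2, h3, h4⟩ := quad_apply hκo hκu hκf hou hof huf x 1 y 0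
    ext i
    simp only [Finsupp.coe_update]
    rcases letters_exhaust hκo hκu hκf hou hof huf i with h | h | h | h <;> rw [h]
    · rw [Function.update_of_ne hκu, Function.update_self, h1]
    · rw [Function.update_of_ne hou, Function.update_of_ne hκo.symm, h2, Finsupp.add_apply, hμ₀, Finsupp.add_apply,
        Finsupp.single_eq_same, Finsupp.single_eq_of_ne hou, Finsupp.single_eq_of_ne hκo.symm]
      omega
    · rw [Function.update_self, h3]
    · rw [Function.update_of_ne huf.symm, Function.update_of_ne hκf.symm, h4, Finsupp.add_apply, hμ₀,
        Finsupp.add_apply, Finsupp.single_eq_of_ne hof.symm, Finsupp.single_eq_of_ne huf.symm,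
        Finsupp.single_eq_of_ne hκf.symm]
      omega
  have he0 : ((μ₀ + Finsupp.single κ 2).update κ (2 - 0)).update u (d - 2 + 0) =
      Finsupp.single κ 2 + Finsupp.single o 1 + Finsupp.single u (d - 2) + Finsupp.single f 0 := hupd _ _ 2 (d - 2) rfl rfl
  have he1 : ((μ₀ + Finsupp.single κ 2).update κ (2 - 1)).update u (d - 2 + 1) =
      Finsupp.single κ 1 + Finsupp.single o 1 + Finsupp.single u (d - 1) + Finsupp.single f 0 :=
    hupd _ _ 1 (d - 1) rfl (by omega)
  have he2 : ((μ₀ + Finsupp.single κ 2).update κ (2 - 2)).update u (d - 2 + 2) =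
      Finsupp.single κ 0 + Finsupp.single o 1 + Finsupp.single u d + Finsupp.single f 0 := hupd _ _ 0 d rfl (by omega)
  -- the dead `ū^{d−2}`-row entry (degree `d + 3 < N`)
  have hnf : coeff (s.r + (Finsupp.single κ 2 + Finsupp.single o 1 + Finsupp.single u (d - 2) + Finsupp.single f 0)) s.F = 0 := by
    by_contra h
    have hmem := mem_support_iff.mpr h
    obtain ⟨-, -, h3, h4⟩ := quad_apply hκo hκu hκf hou hof huf (1 + 2) (1 + 1) (d - 2) 0
    have heq' : s.r + (Finsupp.single κ 2 + Finsupp.single o 1 + Finsupp.single u (d - 2) + Finsupp.single f 0) =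
        Finsupp.single κ (1 + 2) + Finsupp.single o (1 + 1) + Finsupp.single u (d - 2) + Finsupp.single f 0 := by
      rw [hr, Finsupp.single_add, Finsupp.single_add]
      abel
    rw [heq'] at hmem
    exact hrow _ hmem (by rw [degree_quad]; omega) ⟨h3, h4⟩
  -- the pair-ledger entry (`κ`-exponent `1 < 2` at `f`-degree `0`)
  have hW : coeff (s.r + (Finsupp.single κ 0 + Finsupp.single o 1 + Finsupp.single u d + Finsupp.single f 0)) s.F = 0 := by
    by_contra h
    have hmem := mem_support_iff.mpr h
    obtain ⟨h1, -, -, h4⟩ := quad_apply hκo hκu hκf hou hof huf (1 + 0) (1 + 1) d 0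
    have heq' : s.r + (Finsupp.single κ 0 + Finsupp.single o 1 + Finsupp.single u d + Finsupp.single f 0) =
        Finsupp.single κ (1 + 0) + Finsupp.single o (1 + 1) + Finsupp.single u d + Finsupp.single f 0 := by
      rw [hr, Finsupp.single_add, Finsupp.single_add]
      abel
    rw [heq'] at hmem
    have h2 := (hled _ hmem (by rw [h4]; omega)).1
    rw [h1] at h2
    exact absurd h2 (by norm_num)
  -- the flag entry, in the same coordinates
  have hV' : coeff (s.r + (Finsupp.single κ 1 + Finsupp.single o 1 + Finsupp.single u (d - 1) + Finsupp.single f 0)) s.F ≠ 0 := by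
    rw [Finsupp.single_zero, add_zero]
    exact hV
  rw [he0, he1, he2, coeff_divMonomial, coeff_divMonomial, coeff_divMonomial, hnf, hW] at hBμ
  -- `hBμ : _ * 0 + (d−1) * β * V + _ * 0 = 0`
  have h3 : ((d - 2 + 1 : ℕ).choose 1 : K) ≠ 0 := by
    rw [Nat.choose_one_right]
    intro h
    exact Nat.not_dvd_of_pos_of_lt (by omega) (by omega) ((CharP.cast_eq_zero_iff K p _).mp h)
  have hkey : ((d - 2 + 1 : ℕ).choose 1 : K) * β ^ 1 *
      coeff (s.r + (Finsupp.single κ 1 + Finsupp.single o 1 + Finsupp.single u (d - 1) + Finsupp.single f 0)) s.F = 0 := by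
    have h := hBμ
    simp only [mul_zero, zero_add, add_zero] at h
    exact h
  rw [pow_one] at hkey
  rcases mul_eq_zero.mp hkey with h | h
  · rcases mul_eq_zero.mp h with h' | h'
    · exact absurd h' h3
    · exact h'
  · exact absurd h hV'

/-- **(VT-u), TWO-STATE EXPORT, every prime** (the `hVTu` binder of W3 `SwapTransport.translation_eq_zero_of_frame_prime`): a
C∞-presented state — fixed letters `λ μ | u f`, ledger `x_λ x_μ`, order `d + 2`, `x^r ∣ F`, straight residual cone `a·x_f^d`,
exact pair ledger, dead `ū^{d−2}`-row below `N ≥ d + 4`, flag `V ≠ 0` — whose child by a slot step `ℓ ∈ {λ, μ}` with translation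
supported on `u` alone is again of order `d + 2` with `e_G = 3` has NO `u`-translation. [OURS]
[cite: CossartJannsenSaito2020, Thm. 3.10(4), Thm. 9.3] -/
theorem cInf_translation_u_eq_zero_twoState_prime (p : ℕ) [Fact p.Prime] [CharP K p] {d : ℕ} (hdp : d + 1 = p)
    (hd2 : 2 ≤ d) {la mu u f : Fin 4} (hlm : la ≠ mu) (hlu : la ≠ u) (hlf : la ≠ f) (hmu : mu ≠ u) (hmf : mu ≠ f)
    (huf : u ≠ f) {s : State K} {ℓ : Fin 4} (hℓ : ℓ = la ∨ ℓ = mu) (hr : s.r = Finsupp.single la 1 + Finsupp.single mu 1)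
    (ho : ordZero s.F = ((d + 2 : ℕ) : ℕ∞)) (hdiv : ∀ e ∈ s.F.support, s.r ≤ e) {a : K} (ha : a ≠ 0)
    (hform : resForm s = C a * X f ^ d) (hled : ∀ e ∈ s.F.support, e f ≤ d - 1 → 2 ≤ e la ∧ 2 ≤ e mu) {N : ℕ}
    (hN : d + 4 ≤ N) (hrow : ∀ e ∈ s.F.support, e.degree < N → ¬ (e u = d - 2 ∧ e f = 0))
    (hV : coeff (s.r + (Finsupp.single la 1 + Finsupp.single mu 1 + Finsupp.single u (d - 1))) s.F ≠ 0)
    {β : K} (ho' : ordZero (CentreBlowup.step p Finset.univ ℓ (Pi.single u β) s).F = ((d + 2 : ℕ) : ℕ∞))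
    (he3' : Module.finrank K (resVertex (CentreBlowup.step p Finset.univ ℓ (Pi.single u β) s)) = 3) : β = 0 := by
  rcases hℓ with h | h <;> subst h
  · exact cInf_translation_u_eq_zero_twoState_core_prime p hdp hd2 hlm hlu hlf hmu hmf huf hr ho hdiv ha hform hled hN hrow
      hV ho' he3'
  · refine cInf_translation_u_eq_zero_twoState_core_prime p hdp hd2 hlm.symm hmu hmf hlu hlf huf (by rw [hr, add_comm]) ho
      hdiv ha hform (fun e he hf => (hled e he hf).symm) hN hrow ?_ ho' he3'
    rw [show (Finsupp.single ℓ 1 + Finsupp.single la 1 + Finsupp.single u (d - 1) : Fin 4 →₀ ℕ) =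
      Finsupp.single la 1 + Finsupp.single ℓ 1 + Finsupp.single u (d - 1) by abel]
    exact hV

end ResCone

end Summit.ResolutionOfSingularities.ResolutionOfSingularities.Theorems.PIDim4

end
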